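import Summits.ValiantsHypothesis.ValiantsHypothesis.Theorems.DepthWindowLowBiasFibres
import Summits.ValiantsHypothesis.ValiantsHypothesis.Theorems.DepthWindowTwoLetterULB

/-!
# Route `DepthWindow` — `ULB₂` for words with a BOUNDED NUMBER OF LETTER VALUES; no bounded alphabet passes the door

Cone-free theorem (decomp-valiant lens 4, g15; critic-675 NEXT (c), first rung) supporting the crux item
`HomImmHardTwoOne` (stmt-ValiantsHypothesis-30635).  `DepthWindowTwoLetterULB` proved `ULB₂` for two-valued
words (`lowBiasTree_twoLetter`: depth `2·log₂log₂ h + 8`, node bias `6h`).  Here the alphabet may have any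
number `k` of values, at the price of ONE extra level per extra value:

* `lowBiasTree_of_card_image_le` — every word with at most `n + 1` distinct values, `|wᵢ| ≤ h`, `|Σ w| ≤ h`,
  has a low-bias tree of node bias `≤ 6h` at every depth `Δ ≥ 2·⌊log₂⌊log₂ h⌋⌋ + 8 + n` (and at every depth
  `Δ ≥ 2·⌊log₂⌊log₂ d⌋⌋ + 9 + n`);
* `not_boundedLetters_treeBiasGrowthAt` — consequently NO family of words over alphabets of bounded size
  witnesses `TreeBiasGrowthAt a` for a slope `a ≥ 2`: an adversary certifying the A-cell through the tree-bias
  door (`homImmHardAt_two_one_of_treeBiasAt`) must use a number of letter values that is unbounded along the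
  family (indeed `> c` for the instance `(c, C)` it has to serve).

The PEEL.  If both signs and at least three values occur, pick a negative value `a` (all its `N` letters) and a
positive value `b`; after a global sign flip we may assume `N|a| ≤ #b·b`.  Put all `a`-letters and `M'`
`b`-letters into a POOL, `M' = ⌈N|a|/b⌉` if `Σ w ≥ 0` and `⌊N|a|/b⌋` otherwise: the pool is two-valued with
`|Σ_pool| < b ≤ h`, and the rest has one value fewer and STILL `|Σ_rest| ≤ h` (the rounding was chosen towards
the total).  Build the pool by the two-letter theorem and the rest by induction, to the same depth, and GRAFT
(`lowBiasTree_graft` of `DepthWindowLowBiasFibres`) under the two-leaf star `(Σ_pool, Σ_rest)` of mass `≤ 2h`.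

References: [LimayeSrinivasanTavenas2022] CCC 2022 (LIPIcs 234:32) Def. 2, Question 1; full version ECCC
TR22-090 Def. 15, Prop. 16–17; [BhargavDuttaSaxena2024] ACM ToCT 16(4):23 Thm. 1.7 (Barrier) and §5.3: for `γ`
set sizes they partition `[d]` into sub-words with at most two distinct weights — the same pooling — and merge
them in ONE level, paying `γ` in the size exponent (`P_Δ`: `n^{O(Δγd^{μ(Δ)})}`, `Q_Δ`: `n^{O(Δd^{μ(Δ−1)}+γ)}`,
Remark 1.8); here the merge is paid in DEPTH (`+n` levels) at the flat node bias `6h` the door requires.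
-/

-- layout Summits/ValiantsHypothesis/ValiantsHypothesis forces the duplicated namespace component
set_option linter.dupNamespace false

namespace Summit.ValiantsHypothesis.ValiantsHypothesis.Theorems.DepthWindow.TreeBias

open Finset Literature.Computability.AlgebraicComplexity

/-! ### The rounding of one peel -/

/-- **Rounding towards the total.**  With `Q ≤ Mb·b`, `1 ≤ b ≤ h` and `|S| ≤ h` there is `M' ≤ Mb` with
`|M'b − Q| ≤ h` and `|S − (M'b − Q)| ≤ h` (`M' = ⌈Q/b⌉` if `S ≥ 0`, `⌊Q/b⌋` if `S < 0`). [folklore] -/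
theorem peel_arith (Q b Mb h : ℕ) (S : ℤ) (hb : 1 ≤ b) (hbh : b ≤ h) (hQ : Q ≤ Mb * b) (hS : |S| ≤ h) :
    ∃ M' : ℕ, M' ≤ Mb ∧ |(M' : ℤ) * b - Q| ≤ h ∧ |S - ((M' : ℤ) * b - Q)| ≤ h := by
  rw [abs_le] at hS
  have hbh' : (b : ℤ) ≤ h := by exact_mod_cast hbh
  by_cases hS0 : 0 ≤ S
  · -- ceiling
    have e1 : b * ((Q + b - 1) / b) + (Q + b - 1) % b = Q + b - 1 := Nat.div_add_mod _ _
    have e2 : (Q + b - 1) % b < b := Nat.mod_lt _ (by omega)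
    generalize (Q + b - 1) / b = M₀ at e1 ⊢
    have hge : Q ≤ M₀ * b := by rw [Nat.mul_comm]; omega
    have hlt : M₀ * b < Q + b := by rw [Nat.mul_comm]; omega
    have hge' : (Q : ℤ) ≤ (M₀ : ℤ) * b := by exact_mod_cast hge
    have hlt' : (M₀ : ℤ) * b < Q + b := by exact_mod_cast hlt
    refine ⟨M₀, ?_, ?_, ?_⟩
    · have h1 : M₀ * b < (Mb + 1) * b := by rw [add_one_mul]; omega
      exact Nat.lt_succ_iff.1 (Nat.lt_of_mul_lt_mul_right h1)
    · rw [abs_le]; constructor <;> linarith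
    · rw [abs_le]; constructor <;> linarith
  · -- floor
    have hle : Q / b * b ≤ Q := Nat.div_mul_le_self Q b
    have hlt : Q < Q / b * b + b := Nat.lt_div_mul_add (by omega)
    generalize Q / b = M₀ at hle hlt ⊢
    have hle' : (M₀ : ℤ) * b ≤ Q := by exact_mod_cast hle
    have hlt' : (Q : ℤ) < (M₀ : ℤ) * b + b := by exact_mod_cast hlt
    refine ⟨M₀, Nat.le_of_mul_le_mul_right (hle.trans hQ) (by omega), ?_, ?_⟩
    · rw [abs_le]; constructor <;> linarith
    · rw [abs_le]; constructor <;> linarith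

/-! ### One peel -/

/-- **One peel.**  Both signs occur (`a < 0 < b` are values, `a` attained), at least a third value occurs, and
`N|a| ≤ #b·b`; if every shorter-alphabet sub-word with `|letters| ≤ h`, `|Σ| ≤ h` has a depth-`Δ'` low-bias
tree of node bias `6h`, and `Δ'` is in the two-letter range, then `w` has one of depth `Δ' + 1`: the pool
(`a`-letters and `M'` `b`-letters) and the rest side by side, grafted under a two-leaf star.
[cite: LimayeSrinivasanTavenas2022, Def. 15, Prop. 16] -/
theorem peel_step {d : ℕ} (w : Fin d → ℤ) (h : ℕ) (hw : ∀ i, |w i| ≤ h) (hsum : |∑ i, w i| ≤ h) {a b : ℤ}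
    (ha : a < 0) (hb : 0 < b) (hbh : b ≤ h) (hma : ∃ i, w i = a)
    (hcond : ((univ.filter fun j => w j = a).card : ℤ) * (-a) ≤ ((univ.filter fun j => w j = b).card : ℤ) * b)
    (hout : ∃ j, w j ≠ a ∧ w j ≠ b) {Δ' : ℕ}
    (hΔ' : 2 * Nat.log 2 (Nat.log 2 h) + 8 ≤ Δ' ∨ 2 * Nat.log 2 (Nat.log 2 d) + 9 ≤ Δ')
    (ih : ∀ {d₁ : ℕ} (w₁ : Fin d₁ → ℤ), d₁ ≤ d → (univ.image w₁).card < (univ.image w).card →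
      (∀ i, |w₁ i| ≤ h) → |∑ i, w₁ i| ≤ h → LowBiasTree w₁ Δ' ((6 * h : ℕ) : ℤ)) :
    LowBiasTree w (Δ' + 1) ((6 * h : ℕ) : ℤ) := by
  obtain ⟨a', ha'⟩ : ∃ a' : ℕ, (a' : ℤ) = -a := ⟨(-a).toNat, Int.toNat_of_nonneg (by linarith)⟩
  obtain ⟨b', hb'⟩ : ∃ b' : ℕ, (b' : ℤ) = b := ⟨b.toNat, Int.toNat_of_nonneg hb.le⟩
  have hb'1 : 1 ≤ b' := by omega
  have hb'h : b' ≤ h := by have : (b' : ℤ) ≤ h := hb' ▸ hbh; exact_mod_cast this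
  have hQ : (univ.filter fun j => w j = a).card * a' ≤ (univ.filter fun j => w j = b).card * b' := by
    have : ((univ.filter fun j => w j = a).card : ℤ) * (a' : ℤ) ≤
        ((univ.filter fun j => w j = b).card : ℤ) * (b' : ℤ) := by rw [ha', hb']; exact hcond
    exact_mod_cast this
  obtain ⟨M', hM'le, hI, hSI⟩ :=
    peel_arith ((univ.filter fun j => w j = a).card * a') b' (univ.filter fun j => w j = b).card h (∑ i, w i)
      hb'1 hb'h hQ hsum
  obtain ⟨B', hB'sub, hB'card⟩ := exists_subset_card_eq hM'le
  have hmemA : ∀ {j}, j ∈ (univ.filter fun j => w j = a) ↔ w j = a := by simp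
  have hmemB' : ∀ {j}, j ∈ B' → w j = b := fun hj => by simpa using hB'sub hj
  have hdisj : Disjoint (univ.filter fun j => w j = a) B' := by
    rw [disjoint_left]; intro j hjA hjB
    have := (hmemA.1 hjA).symm.trans (hmemB' hjB); linarith
  -- the grouping: pool ↦ 0, rest ↦ 1
  let c : Fin d → Fin 2 := fun j => if j ∈ (univ.filter fun j => w j = a) ∪ B' then 0 else 1
  have hc0 : ∀ j, c j = 0 ↔ j ∈ (univ.filter fun j => w j = a) ∪ B' := fun j => by
    simp only [c]; split_ifs with hj <;> simp [hj]
  obtain ⟨i₀, hi₀⟩ := hma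
  obtain ⟨j₁, hj₁a, hj₁b⟩ := hout
  have hi₀P : c i₀ = 0 := (hc0 i₀).2 (mem_union_left _ (hmemA.2 hi₀))
  have hj₁P : c j₁ = 1 := by
    have : ¬ c j₁ = 0 := fun h0 => by
      rcases mem_union.1 ((hc0 j₁).1 h0) with hj | hj
      · exact hj₁a (hmemA.1 hj)
      · exact hj₁b (hmemB' hj)
    omega
  have hc : Function.Surjective c := Fin.forall_fin_two.2 ⟨⟨i₀, hi₀P⟩, ⟨j₁, hj₁P⟩⟩
  -- pool sum and rest sum
  have hq0 : quotWord w c 0 = (M' : ℤ) * b' - ((univ.filter fun j => w j = a).card * a' : ℕ) := by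
    unfold quotWord
    rw [show (univ.filter fun j => c j = 0) = (univ.filter fun j => w j = a) ∪ B' by ext j; simpa using hc0 j,
      sum_union hdisj, sum_congr rfl fun j hj => hmemA.1 hj, sum_congr rfl fun j hj => hmemB' hj, sum_const,
      sum_const, hB'card, nsmul_eq_mul, nsmul_eq_mul]
    push_cast
    rw [ha', hb']
    ring
  have hq1 : quotWord w c 1 = ∑ i, w i - quotWord w c 0 := by
    have := sum_quotWord w c; rw [Fin.sum_univ_two] at this; linarith
  have hI' : |quotWord w c 0| ≤ h := by rw [hq0]; exact hI
  have hSI' : |quotWord w c 1| ≤ h := by rw [hq1, hq0]; exact hSI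
  -- the two fibres
  have hΔ'1 : 1 ≤ Δ' := by omega
  have hcard : ∀ m, (fib c m).card ≤ d := fun m => (card_le_univ _).trans (by simp)
  have hΔ'm : ∀ m, 2 * Nat.log 2 (Nat.log 2 h) + 8 ≤ Δ' ∨ 2 * Nat.log 2 (Nat.log 2 (fib c m).card) + 9 ≤ Δ' :=
    fun m => hΔ'.imp id fun h2 => le_trans (by
      have := Nat.log_mono_right (b := 2) (Nat.log_mono_right (b := 2) (hcard m)); omega) h2
  have hfib : ∀ m, LowBiasTree (w ∘ emb c m) Δ' ((6 * h : ℕ) : ℤ) := by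
    refine Fin.forall_fin_two.2 ⟨?_, ?_⟩
    · -- the pool: two-valued, balanced
      refine lowBiasTree_twoLetter _ h ⟨a, b, fun i => ?_⟩ (fun i => hw _) ?_ (hΔ'm 0)
      · have h0 := (hc0 _).1 (c_emb c 0 i)
        rcases mem_union.1 h0 with hj | hj
        · exact Or.inl (hmemA.1 hj)
        · exact Or.inr (hmemB' hj)
      · simpa [Function.comp, sum_comp_emb] using hI'
    · -- the rest: one value fewer, still balanced
      refine ih _ (hcard 1) ?_ (fun i => hw _) (by simpa [Function.comp, sum_comp_emb] using hSI')
      have hsub : univ.image (w ∘ emb c 1) ⊆ (univ.image w).erase a := by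
        intro x hx
        obtain ⟨i, -, rfl⟩ := mem_image.1 hx
        refine mem_erase.2 ⟨fun hxa => ?_, mem_image_of_mem _ (mem_univ _)⟩
        have h1 := c_emb c 1 i
        have h0 : c (emb c 1 i) = 0 := (hc0 _).2 (mem_union_left _ (hmemA.2 hxa))
        rw [h0] at h1; exact absurd h1 (by decide)
      have hmem_a : a ∈ univ.image w := mem_image.2 ⟨i₀, mem_univ _, hi₀⟩
      exact lt_of_le_of_lt (card_le_card hsub) (card_erase_lt_of_mem hmem_a)
  -- the two-leaf star on top
  have hq : LowBiasTree (quotWord w c) 1 ((6 * h : ℕ) : ℤ) := by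
    apply lowBiasTree_one_of_sum_abs_le
    rw [Fin.sum_univ_two]
    have : (h : ℤ) + h ≤ ((6 * h : ℕ) : ℤ) := by push_cast; linarith
    linarith [hI', hSI']
  exact lowBiasTree_graft c hc hΔ'1 hfib hq

/-! ### `ULB₂` on bounded alphabets -/

/-- **`ULB₂` for words with at most `n + 1` values.**  Every such word with `|wᵢ| ≤ h` and `|Σ wᵢ| ≤ h` has a
levelled tree with all node biases `≤ 6h` at every depth `Δ ≥ 2·⌊log₂⌊log₂ h⌋⌋ + 8 + n`, and at every depth
`Δ ≥ 2·⌊log₂⌊log₂ d⌋⌋ + 9 + n` (induction on `n` by peeling, `peel_step`; one-signed words are stars and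
two-valued words are `lowBiasTree_twoLetter`). [cite: LimayeSrinivasanTavenas2022, Question 1] -/
theorem lowBiasTree_of_card_image_le (h : ℕ) : ∀ (n : ℕ) {d : ℕ} (w : Fin d → ℤ),
    (univ.image w).card ≤ n + 1 → (∀ i, |w i| ≤ h) → |∑ i, w i| ≤ h → ∀ {Δ : ℕ},
    (2 * Nat.log 2 (Nat.log 2 h) + 8 + n ≤ Δ ∨ 2 * Nat.log 2 (Nat.log 2 d) + 9 + n ≤ Δ) →
    LowBiasTree w Δ ((6 * h : ℕ) : ℤ)
  | 0, d, w, hk, hw, hsum, Δ, hΔ => by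
      -- one value, hence one sign: the star
      apply lowBiasTree_of_sum_abs_le _ (by omega : 1 ≤ Δ)
      have hsgn : (∀ i, 0 ≤ w i) ∨ (∀ i, w i ≤ 0) := by
        have heq : ∀ i j, w i = w j := fun i j =>
          card_le_one.1 hk _ (mem_image_of_mem _ (mem_univ i)) _ (mem_image_of_mem _ (mem_univ j))
        by_cases h0 : ∀ i, 0 ≤ w i
        · exact Or.inl h0
        · push Not at h0
          obtain ⟨i, hi⟩ := h0
          exact Or.inr fun j => by rw [heq j i]; exact hi.le
      rw [sum_abs_eq_abs_sum_of_sameSign w hsgn]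
      exact hsum.trans (by push_cast; linarith)
  | n + 1, d, w, hk, hw, hsum, Δ, hΔ => by
      by_cases hsgn : (∀ i, 0 ≤ w i) ∨ (∀ i, w i ≤ 0)
      · apply lowBiasTree_of_sum_abs_le _ (by omega : 1 ≤ Δ)
        rw [sum_abs_eq_abs_sum_of_sameSign w hsgn]
        exact hsum.trans (by push_cast; linarith)
      by_cases h2 : ∃ x y : ℤ, ∀ i, w i = x ∨ w i = y
      · exact lowBiasTree_twoLetter w h h2 hw hsum (by omega)
      push Not at hsgn
      obtain ⟨⟨i₀, hi₀⟩, ⟨j₀, hj₀⟩⟩ := hsgn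
      obtain ⟨Δ', rfl⟩ : ∃ Δ', Δ = Δ' + 1 := ⟨Δ - 1, by omega⟩
      have hΔ' : 2 * Nat.log 2 (Nat.log 2 h) + 8 ≤ Δ' ∨ 2 * Nat.log 2 (Nat.log 2 d) + 9 ≤ Δ' := by omega
      have ih : ∀ {d₁ : ℕ} (w₁ : Fin d₁ → ℤ), d₁ ≤ d → (univ.image w₁).card < (univ.image w).card →
          (∀ i, |w₁ i| ≤ h) → |∑ i, w₁ i| ≤ h → LowBiasTree w₁ Δ' ((6 * h : ℕ) : ℤ) :=
        fun w₁ hd₁ hc₁ hw₁ hs₁ => lowBiasTree_of_card_image_le h n w₁ (by omega) hw₁ hs₁ (by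
          have := Nat.log_mono_right (b := 2) (Nat.log_mono_right (b := 2) hd₁); omega)
      have hout : ∀ x y : ℤ, ∃ j, w j ≠ x ∧ w j ≠ y := fun x y => by
        by_contra hc
        push Not at hc
        exact h2 ⟨x, y, fun i => (em (w i = x)).imp id (hc i)⟩
      have hah : -w i₀ ≤ h := by have := hw i₀; rwa [abs_of_neg hi₀] at this
      have hbh : w j₀ ≤ h := by have := hw j₀; rwa [abs_of_pos hj₀] at this
      rcases le_or_gt (((univ.filter fun j => w j = w i₀).card : ℤ) * (-w i₀))
          (((univ.filter fun j => w j = w j₀).card : ℤ) * w j₀) with hle | hlt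
      · exact peel_step w h hw hsum hi₀ hj₀ hbh ⟨i₀, rfl⟩ hle (hout _ _) hΔ' ih
      · -- flip all signs: now the (former) positive value is the scarce one
        have e1 : (univ.filter fun j => -w j = -w j₀) = univ.filter fun j => w j = w j₀ := by
          ext j; simp [neg_inj]
        have e2 : (univ.filter fun j => -w j = -w i₀) = univ.filter fun j => w j = w i₀ := by
          ext j; simp [neg_inj]
        have himg : (univ.image fun i => -w i) = (univ.image w).image Neg.neg := by
          rw [image_image]; rfl
        have hν := peel_step (fun i => -w i) h (fun i => by rw [abs_neg]; exact hw i)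
          (by rw [sum_neg_distrib, abs_neg]; exact hsum) (a := -w j₀) (b := -w i₀) (by linarith) (by linarith)
          hah ⟨j₀, rfl⟩ (by rw [e1, e2, neg_neg]; exact hlt.le)
          (by obtain ⟨j, hja, hjb⟩ := hout (w j₀) (w i₀); exact ⟨j, by simpa using hja, by simpa using hjb⟩)
          hΔ' (fun w₁ hd₁ hc₁ hw₁ hs₁ => ih w₁ hd₁
            (by rwa [himg, card_image_of_injective _ neg_injective] at hc₁) hw₁ hs₁)
        simpa using hν.neg

/-- **Bounded alphabets cannot witness `TreeBiasGrowthAt a` for any slope `a ≥ 2`.**  The statement negated is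
`TreeBiasGrowthAt a` with the conjunct «the word has at most `k + 1` distinct values» added; instance `c := 9 + k`,
`C := 6`. [cite: BhargavDuttaSaxena2024, Thm. 1.4] -/
theorem not_boundedLetters_treeBiasGrowthAt {a : ℕ} (ha : 2 ≤ a) (k : ℕ) :
    ¬ (∀ c C : ℕ, ∃ m₀ : ℕ, ∀ m : ℕ, m₀ ≤ m →
        ∀ Δ : ℕ, Δ ≤ a * Nat.log 2 (Nat.log 2 (Nat.log 2 m)) + c + 1 →
          ∃ (sz : Fin (Nat.sqrt (Nat.log 2 m)) → ℕ) (pos : Fin (Nat.sqrt (Nat.log 2 m)) → Bool),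
            (∀ i, 1 ≤ sz i) ∧ (∀ t ≤ Nat.sqrt (Nat.log 2 m), 2 ^ GenWord.overLen sz pos t ≤ m) ∧
            (univ.image (GenWord.wt sz pos)).card ≤ k + 1 ∧
            TreeBiasGe (GenWord.wt sz pos) Δ
              (2 * (C * (a * Nat.log 2 (Nat.log 2 (Nat.log 2 m)) + c + 2) * Nat.log 2 m))) := by
  intro hG
  obtain ⟨m₀, hm₀⟩ := hG (9 + k) 6
  obtain ⟨m, hmm₀, hm2⟩ : ∃ m, m₀ ≤ m ∧ 2 ≤ m := ⟨max m₀ 2, le_max_left _ _, le_max_right _ _⟩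
  have hL : 1 ≤ Nat.log 2 m := Nat.le_log_of_pow_le one_lt_two (by simpa using hm2)
  obtain ⟨sz, pos, _hsz, hfit, hk, hTB⟩ := hm₀ m hmm₀ _ le_rfl
  have hwi : ∀ i, |GenWord.wt sz pos i| ≤ ((2 * Nat.log 2 m : ℕ) : ℤ) := fun i => abs_wt_le sz pos hfit i
  have hws : |∑ i, GenWord.wt sz pos i| ≤ ((2 * Nat.log 2 m : ℕ) : ℤ) :=
    le_trans (abs_sum_wt_le sz pos hfit) (by push_cast; linarith)
  -- depth bookkeeping: 2·log₂log₂(2L) + 8 + k ≤ 2X + 10 + k ≤ aX + (9 + k) + 1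
  have hdepth : 2 * Nat.log 2 (Nat.log 2 (2 * Nat.log 2 m)) + 8 + k ≤
      a * Nat.log 2 (Nat.log 2 (Nat.log 2 m)) + (9 + k) + 1 := by
    have h1 : Nat.log 2 (2 * Nat.log 2 m) = Nat.log 2 (Nat.log 2 m) + 1 := by
      rw [Nat.mul_comm]; exact Nat.log_mul_base one_lt_two (by omega)
    have h2 : Nat.log 2 (Nat.log 2 (Nat.log 2 m) + 1) ≤ Nat.log 2 (Nat.log 2 (Nat.log 2 m)) + 1 :=
      (le_trans (Nat.log_mono_right (Nat.lt_pow_succ_log_self one_lt_two _)) (Nat.log_pow one_lt_two _).le)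
    have h3 : 2 * Nat.log 2 (Nat.log 2 (Nat.log 2 m)) ≤ a * Nat.log 2 (Nat.log 2 (Nat.log 2 m)) :=
      Nat.mul_le_mul_right _ ha
    rw [h1]; omega
  have hT := lowBiasTree_of_card_image_le (2 * Nat.log 2 m) k (GenWord.wt sz pos) hk hwi hws (Or.inl hdepth)
  refine not_treeBiasGe_of_lowBiasTree hT ?_ hTB
  have hnat : (a * Nat.log 2 (Nat.log 2 (Nat.log 2 m)) + (9 + k) + 1) * (6 * (2 * Nat.log 2 m)) <
      2 * (6 * (a * Nat.log 2 (Nat.log 2 (Nat.log 2 m)) + (9 + k) + 2) * Nat.log 2 m) := by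
    have : (a * Nat.log 2 (Nat.log 2 (Nat.log 2 m)) + (9 + k) + 1) * (6 * (2 * Nat.log 2 m)) +
        12 * Nat.log 2 m = 2 * (6 * (a * Nat.log 2 (Nat.log 2 (Nat.log 2 m)) + (9 + k) + 2) * Nat.log 2 m) := by
      ring
    omega
  exact_mod_cast hnat

end Summit.ValiantsHypothesis.ValiantsHypothesis.Theorems.DepthWindow.TreeBias
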